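import Literature.AnabelianGeometry.EtaleTheta.Discharge.Sec5Thm56EndKnitLevelNPsi
import Literature.AnabelianGeometry.EtaleTheta.Discharge.Sec5Thm56EndKnitLevelNCarrierRoofs
import HarnessLib

/-!
# [EtTh] Prop. 5.5 ⊕ Thm. 5.6 (i) at the genuine level-`N` §5 data — END-KNIT swap pass, layer 3f (`aΨ := deltaTransport`), ROOF FORM (proof-only)

S. Mochizuki, *The étale theta function and its Frobenioid-theoretic manifestations*, Publ. RIMS **45** (2009) [MochizukiEtTh2009],
Prop. 5.5 p.327, proof p.328 (PDF p.102) l.2–11 (transport by ROOFS `S″ → S`, `S″ → S′`); Thm. 5.6 p.328, proof p.329 (PDF p.103).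

abc-iut cell, layer L2, seat abc-iut-w5-d013 (gen 6), ruling R571 (abc-iut-L2-lead gen 5: «END-KNIT swap pass on the node closers of record
(K4 (C2) list loses hreach and the all-φ hpull) = GO w5-d013»).  PROOF-ONLY (no definition, no new named fact).  ROOF TWIN(S) of
`…_levelN_psi` of `Sec5Thm56EndKnitLevelNPsi.lean` (abc-iut-w5-d034 / w5-d020 / w4-d042 / w5-d013 lineages) — the original is NOT
edited; each twin has the SAME statement except for the binder delta below and the SAME proof text except that it calls the `_roofs` twin one
layer down and threads `hroof hmeet` where the original threads `hreach`; every producer is consumed BY NAME exactly as in the original.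

BINDER DELTA (everything else verbatim, same conclusion):
* `hreach : LinearlyReachableFromBN _` (abc-iut-L2-t4's fixed-source transport step = FACT row F-0735, class refuted-closure: a DEPTH constraint
  over `B^temp(Π)⁰`, F-w5d013g5-1; c312-2 CONE-K4-RECLOSE v4 row EtTh:Prop5.5) ↦ print's roofs `hroof` (one roof `B_N ⟵b R a⟶ T` of linear
  morphisms from a theta-saturated `R` per theta-saturated `T`, legs onto on `(l·Δ_Θ) ⊗ ℤ/Nℤ` and injective on `μ_N`) + `hmeet` (two roofs of
  `T` meet at a theta-saturated `R₀` over one base map) — anonymous ∀/∃-binders, NOT FACT rows;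
* abc-iut-L2-d4's unit pull-back naturality `hpull` ↦ its clause at LINEAR `φ` (the only use; a THEOREM at this data modulo `hnd`:
  `hpull_of_isLinear_ofConnectedTemperoidData`, p449195).
Chain of twins: p462110 (ofBiKummerData) → p464796 (`_of_leaves_roofs`) → p465126 (`_allLeaves_roofs`, `_final_roofs`, `_final_deltaCompat_roofs`)
→ the level-`N` files `Sec5Thm56EndKnitLevelN*Roofs` (`_levelN_roofs` → `_projPin_roofs` → `_Ydd_roofs` / `_modelHyps_roofs`; `_carrier_roofs` →
`_psi_roofs`; `_modelHyps_psi_roofs` → `_forall_roofs`).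
HONEST FRAMING: kernel-checked implications between typed statements about the genuine §5 data; the roofs, their meeting, the pins, the
transports and the model hypotheses are HYPOTHESES, not asserted (at this carrier `hroof`/`hmeet` are neither derivable nor refutable, but
unlike `hreach` they are print's own shape and not a depth constraint); nothing asserts that such data exist for an actual curve; [EtTh] is
refereed pre-IUT material; nothing here bears on [IUTchIII] Cor. 3.12 — no side is taken; typed ≠ proved.
-/

noncomputable section

namespace Literature.AnabelianGeometry.EtaleTheta

open CategoryTheory Opposite FrobenioidCyclotomicRigidity Literature.AlgebraicGeometry.Frobenioids
  Literature.AnabelianGeometry.SemiGraphs Literature.AnabelianGeometry.SemiGraphs.GaloisObjects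

universe u₀ v₀ w' v₁ u₁

namespace ThetaFrobenioid

section Connected

variable {K : Type u₀} [Field K] {X : SemiGraphs.TemperedArithmeticGroup.{u₀} K} {D₀ : Type u₀} [Category.{v₀} D₀]
  {V : FrdIMonoidStub.{max u₀ w'}} {T₀ : RealifiedDivisorMonoids (D₀ := D₀) V}
  {VD : FrdICatStub.{u₀ + 1, u₀, max u₀ w'} (ConnectedPart (BTemp X.Pi))}
  {tf : TemperedFrobenioid T₀ (ConnectedPart (BTemp X.Pi)) VD} {hZ : tf.monoidType = MonoidType.Z}
  {hP : ∀ A : (ConnectedPart (BTemp X.Pi))ᵒᵖ, IsPerfect (tf.Φ.carrier A)}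
  {NH : Subgroup (Field.absoluteGaloisGroup K) → tf.category → ℕ+ → Prop} {A₀ : tf.category}
  {hA₀ : PreFrobenioid.IsFrobeniusTrivial tf.toElem A₀} {hA₀' : SemiGraphs.IsGaloisObj A₀.base.obj}
  {lv N : ℕ+} {l' : ℕ} {RD : RigidData.{max u₀ w'} N l'}
  {pullFrac : ∀ {A A' : (BiKummerSetting.mkOfConnectedTemperoid X tf hZ hP NH A₀ hA₀ hA₀').C} (_ : A' ⟶ A),
    (BiKummerSetting.mkOfConnectedTemperoid X tf hZ hP NH A₀ hA₀ hA₀').biratUnits A →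
      (BiKummerSetting.mkOfConnectedTemperoid X tf hZ hP NH A₀ hA₀ hA₀').biratUnits A'}
  {θ : (BiKummerSetting.mkOfConnectedTemperoid X tf hZ hP NH A₀ hA₀ hA₀').biratUnits
    (BiKummerSetting.mkOfConnectedTemperoid X tf hZ hP NH A₀ hA₀ hA₀').Aodot}
  {Bl : (BiKummerSetting.mkOfConnectedTemperoid X tf hZ hP NH A₀ hA₀ hA₀').C}
  {Pl : (BiKummerSetting.mkOfConnectedTemperoid X tf hZ hP NH A₀ hA₀ hA₀').FractionPair θ Bl}
  {Rl : (BiKummerSetting.mkOfConnectedTemperoid X tf hZ hP NH A₀ hA₀ hA₀').NthRoot θ Pl lv pullFrac}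
  (h : ModelFrobenioid.Hypotheses tf.divisorMonoid tf.ratFnFunctor)
  (odd_l : Odd (lv : ℕ))
  (R : (BiKummerSetting.mkOfConnectedTemperoid X tf hZ hP NH A₀ hA₀ hA₀').NthRoot Rl.root Rl.pair N pullFrac)
  (ιX : RD.PiX ≃ₜ* X.Pi) (K' : Type (max u₀ w')) [Field K'] (constEmb : K'ˣ →* tf.biratUnitsModel R.BN)
  (constEmb_injective : Function.Injective constEmb)
  (hinvc : ∀ g : Aut R.AN.base,
    pull tf.divisorMonoid g.hom (ModelFrobenioid.div R.pair.num) = ModelFrobenioid.div R.pair.num)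
  (hinvp : ∀ y : RD.PiX, y ∈ RD.PiYdd →
    pull tf.divisorMonoid ((BiKummerSetting.mkOfConnectedTemperoid X tf hZ hP NH A₀ hA₀ hA₀').galoisSurj R.AN.base
      R.αData.isGalois (ιX y)).hom (ModelFrobenioid.div R.pair.den) = ModelFrobenioid.div R.pair.den)

/-- **ROOF TWIN of `exists_rigidityFamily_unique_preserved_ofConnectedTemperoidData_levelN_psi`** — abc-iut-w5-d034ʼs FILE C: the carrier knit at `aΨ := deltaTransport` (abc-iut-w5-d020 p443762 over this seatʼs `ThetaSubquotient.psiTransport`), with `haΨn` / T56-L09c from `map_psiTransport` / `deltaCompat_carrier_of_psiTransport`; binder delta: `hreach ↦ hroof + hmeet`, `hpull` linear-only; statement and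
proof otherwise verbatim the original's (module docstring).  [cite: MochizukiEtTh2009, Thm 5.6 p.328 (PDF p.102); Prop 5.5 proof p.328 (PDF p.102)] -/
theorem exists_rigidityFamily_unique_preserved_ofConnectedTemperoidData_levelN_psi_roofs
    -- Prop 5.5 side (η / ν pin, reachability, stub laws)
    (hB : (ofConnectedTemperoidData h (RD.levelStub ιX) odd_l R ιX K' constEmb constEmb_injective hinvc hinvp).IsThetaSaturated (ofConnectedTemperoidData h (RD.levelStub ιX) odd_l R ιX K' constEmb constEmb_injective hinvc hinvp).BN) (P : ThetaSubquotientProj (ofConnectedTemperoidData h (RD.levelStub ιX) odd_l R ιX K' constEmb constEmb_injective hinvc hinvp))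
    -- the ONE pin: `P` at `B_N^bs` is print's `Aut`-subquotient domain `autPre q_N ι_N` read through `Aut_D(B_N^bs) ↪ Aut(B_N^bs.obj)`
    -- (abc-iut-w4-d042's `hPpre`; DUAL CLAUSE G-w4d042g3-1: no `P`-TERM until v-next `proj_surjective_of_isGaloisObj`)
    (hPpre : P.pre R.BN.base =
      (ThetaSubquotient.autPre (RD.qN ιX) RD.iotaN R.BN.base.obj).comap (Functor.mapAut R.BN.base (connectedObjects (BTemp X.Pi)).ι))
    [RD.iotaN.range.Normal]
    -- the SECOND pin: `P.proj` at `B_N^bs` IS print's projection `autProj q_N ι_N` (abc-iut-w4-d042's proj-pin convention; its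
    -- producers `e`/`he`/`hPproj`/`hproj` under this pin are abc-iut-w4-d042's row — here only CONSUMED as hypotheses)
    (hPproj_pin : ∀ (g : Aut ((ofConnectedTemperoidData h (RD.levelStub ιX) odd_l R ιX K' constEmb constEmb_injective hinvc hinvp).base.obj (ofConnectedTemperoidData h (RD.levelStub ιX) odd_l R ιX K' constEmb constEmb_injective hinvc hinvp).BN)) (hg : g ∈ P.pre ((ofConnectedTemperoidData h (RD.levelStub ιX) odd_l R ιX K' constEmb constEmb_injective hinvc hinvp).base.obj (ofConnectedTemperoidData h (RD.levelStub ιX) odd_l R ιX K' constEmb constEmb_injective hinvc hinvp).BN))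
      (hg' : Functor.mapAut R.BN.base (connectedObjects (BTemp X.Pi)).ι g ∈ ThetaSubquotient.autPre (RD.qN ιX) RD.iotaN R.BN.base.obj),
      P.proj ((ofConnectedTemperoidData h (RD.levelStub ιX) odd_l R ιX K' constEmb constEmb_injective hinvc hinvp).base.obj (ofConnectedTemperoidData h (RD.levelStub ιX) odd_l R ιX K' constEmb constEmb_injective hinvc hinvp).BN) ⟨g, hg⟩ = ThetaSubquotient.autProj (RD.qN ιX) RD.iotaN R.BN.base.obj ⟨_, hg'⟩)
    {η₀ : RD.PiYdd → RD.mu} (hη₀ : η₀ ∈ RD.thetaCocycles)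
    (hdies : ∀ k : RD.PiYdd, rhoOfBiKummerData R ιX k = 1 → η₀ k = 1)
    (e : RD.mu → (ofConnectedTemperoidData h (RD.levelStub ιX) odd_l R ιX K' constEmb constEmb_injective hinvc hinvp).lDeltaModN (ofConnectedTemperoidData h (RD.levelStub ιX) odd_l R ιX K' constEmb constEmb_injective hinvc hinvp).BN) (he : Function.Surjective e)
    (hPproj : ∀ (k : RD.PiYdd) (hk : (k : RD.PiX) ∈ RD.lDeltaTheta) (hm : rhoOfBiKummerData R ιX k ∈ P.pre _),
      (QuotientGroup.mk (P.proj _ ⟨rhoOfBiKummerData R ιX k, hm⟩) : (ofConnectedTemperoidData h (RD.levelStub ιX) odd_l R ιX K' constEmb constEmb_injective hinvc hinvp).lDeltaModN (ofConnectedTemperoidData h (RD.levelStub ιX) odd_l R ιX K' constEmb constEmb_injective hinvc hinvp).BN) = e (RD.thetaMod ⟨k, hk⟩))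
    (ν : (ofConnectedTemperoidData h (RD.levelStub ιX) odd_l R ιX K' constEmb constEmb_injective hinvc hinvp).lDeltaModN (ofConnectedTemperoidData h (RD.levelStub ιX) odd_l R ιX K' constEmb constEmb_injective hinvc hinvp).BN ≃* (ofConnectedTemperoidData h (RD.levelStub ιX) odd_l R ιX K' constEmb constEmb_injective hinvc hinvp).muTorsion (ofConnectedTemperoidData h (RD.levelStub ιX) odd_l R ιX K' constEmb constEmb_injective hinvc hinvp).BN (ofConnectedTemperoidData h (RD.levelStub ιX) odd_l R ιX K' constEmb constEmb_injective hinvc hinvp).N)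
    (hKν : ∀ η : (ofConnectedTemperoidData h (RD.levelStub ιX) odd_l R ιX K' constEmb constEmb_injective hinvc hinvp).HB → (ofConnectedTemperoidData h (RD.levelStub ιX) odd_l R ιX K' constEmb constEmb_injective hinvc hinvp).lDeltaModN (ofConnectedTemperoidData h (RD.levelStub ιX) odd_l R ιX K' constEmb constEmb_injective hinvc hinvp).BN,
      (∀ k : RD.PiYdd, η ⟨rhoOfBiKummerData R ιX k, Subgroup.mem_map_of_mem _ k.2⟩ = e (η₀ k)) →
        FrobenioidThetaBiKummer.ThetaPairKummerClass (ofConnectedTemperoidData h (RD.levelStub ιX) odd_l R ιX K' constEmb constEmb_injective hinvc hinvp) η ν)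
    -- T56-L09b: Prop 3.4 (ii) constants + the origin clause «cnst kills Ker aug» (G-w5d020-2)
    {Dcnst : Type u₁} [Category.{v₁} Dcnst] {cnst : D₀ ⥤ Dcnst} (hP34 : RealifiedDivisorMonoids.Prop34Cnst T₀ cnst)
    (hΔcnst : ∀ δ ∈ RD.aug.ker,
      cnst.map (tf.base.map (rhoOfBiKummerData R ιX δ).hom) = 𝟙 (cnst.obj (tf.base.obj R.BN.base)))
    -- print's ROOFS (replacing `hreach`): one roof per theta-saturated object, and two roofs of `T` meet
    (hroof : ∀ T : (BiKummerSetting.mkOfConnectedTemperoid X tf hZ hP NH A₀ hA₀ hA₀').C, (ofConnectedTemperoidData h (RD.levelStub ιX) odd_l R ιX K' constEmb constEmb_injective hinvc hinvp).IsThetaSaturated T →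
      ∃ (R' : (BiKummerSetting.mkOfConnectedTemperoid X tf hZ hP NH A₀ hA₀ hA₀').C) (_ : (ofConnectedTemperoidData h (RD.levelStub ιX) odd_l R ιX K' constEmb constEmb_injective hinvc hinvp).IsThetaSaturated R') (a : R' ⟶ T) (b : R' ⟶ (ofConnectedTemperoidData h (RD.levelStub ιX) odd_l R ιX K' constEmb constEmb_injective hinvc hinvp).BN),
        (ofConnectedTemperoidData h (RD.levelStub ιX) odd_l R ιX K' constEmb constEmb_injective hinvc hinvp).IsLinear a ∧ (ofConnectedTemperoidData h (RD.levelStub ιX) odd_l R ιX K' constEmb constEmb_injective hinvc hinvp).IsLinear b ∧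
        Function.Surjective ((ofConnectedTemperoidData h (RD.levelStub ιX) odd_l R ιX K' constEmb constEmb_injective hinvc hinvp).lDeltaModNMap a) ∧ Function.Injective ((ofConnectedTemperoidData h (RD.levelStub ιX) odd_l R ιX K' constEmb constEmb_injective hinvc hinvp).muTorsionPull a (ofConnectedTemperoidData h (RD.levelStub ιX) odd_l R ιX K' constEmb constEmb_injective hinvc hinvp).N) ∧
        Function.Surjective ((ofConnectedTemperoidData h (RD.levelStub ιX) odd_l R ιX K' constEmb constEmb_injective hinvc hinvp).lDeltaModNMap b) ∧ Function.Injective ((ofConnectedTemperoidData h (RD.levelStub ιX) odd_l R ιX K' constEmb constEmb_injective hinvc hinvp).muTorsionPull b (ofConnectedTemperoidData h (RD.levelStub ιX) odd_l R ιX K' constEmb constEmb_injective hinvc hinvp).N))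
    (hmeet : ∀ (T : (BiKummerSetting.mkOfConnectedTemperoid X tf hZ hP NH A₀ hA₀ hA₀').C), (ofConnectedTemperoidData h (RD.levelStub ιX) odd_l R ιX K' constEmb constEmb_injective hinvc hinvp).IsThetaSaturated T →
      ∀ (R₁ : (BiKummerSetting.mkOfConnectedTemperoid X tf hZ hP NH A₀ hA₀ hA₀').C), (ofConnectedTemperoidData h (RD.levelStub ιX) odd_l R ιX K' constEmb constEmb_injective hinvc hinvp).IsThetaSaturated R₁ → ∀ (a : R₁ ⟶ T), (ofConnectedTemperoidData h (RD.levelStub ιX) odd_l R ιX K' constEmb constEmb_injective hinvc hinvp).IsLinear a →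
      ∀ (R₂ : (BiKummerSetting.mkOfConnectedTemperoid X tf hZ hP NH A₀ hA₀ hA₀').C), (ofConnectedTemperoidData h (RD.levelStub ιX) odd_l R ιX K' constEmb constEmb_injective hinvc hinvp).IsThetaSaturated R₂ → ∀ (a' : R₂ ⟶ T), (ofConnectedTemperoidData h (RD.levelStub ιX) odd_l R ιX K' constEmb constEmb_injective hinvc hinvp).IsLinear a' →
      ∃ (R₀ : (BiKummerSetting.mkOfConnectedTemperoid X tf hZ hP NH A₀ hA₀ hA₀').C) (_ : (ofConnectedTemperoidData h (RD.levelStub ιX) odd_l R ιX K' constEmb constEmb_injective hinvc hinvp).IsThetaSaturated R₀) (c : R₀ ⟶ R₁) (c' : R₀ ⟶ R₂),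
        (ofConnectedTemperoidData h (RD.levelStub ιX) odd_l R ιX K' constEmb constEmb_injective hinvc hinvp).IsLinear c ∧ (ofConnectedTemperoidData h (RD.levelStub ιX) odd_l R ιX K' constEmb constEmb_injective hinvc hinvp).IsLinear c' ∧ (ofConnectedTemperoidData h (RD.levelStub ιX) odd_l R ιX K' constEmb constEmb_injective hinvc hinvp).base.map (c ≫ a) = (ofConnectedTemperoidData h (RD.levelStub ιX) odd_l R ιX K' constEmb constEmb_injective hinvc hinvp).base.map (c' ≫ a') ∧
        Function.Surjective ((ofConnectedTemperoidData h (RD.levelStub ιX) odd_l R ιX K' constEmb constEmb_injective hinvc hinvp).lDeltaModNMap c') ∧ Function.Injective ((ofConnectedTemperoidData h (RD.levelStub ιX) odd_l R ιX K' constEmb constEmb_injective hinvc hinvp).muTorsionPull c' (ofConnectedTemperoidData h (RD.levelStub ιX) odd_l R ιX K' constEmb constEmb_injective hinvc hinvp).N))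
    -- P55-L06 leaves: hproj named (leaf (G-in) is a THEOREM here: [SemiAnbd] Def 3.1 (iv) read in B^temp(Π)⁰)
    (hproj : ∀ (g g' : Aut ((ofConnectedTemperoidData h (RD.levelStub ιX) odd_l R ιX K' constEmb constEmb_injective hinvc hinvp).base.obj (ofConnectedTemperoidData h (RD.levelStub ιX) odd_l R ιX K' constEmb constEmb_injective hinvc hinvp).BN)) (hh : g' ∈ P.pre _), ∃ hgh : g * g' * g⁻¹ ∈ P.pre _,
      (ofConnectedTemperoidData h (RD.levelStub ιX) odd_l R ιX K' constEmb constEmb_injective hinvc hinvp).lDeltaMap g.hom (P.proj _ ⟨g', hh⟩) = P.proj _ ⟨g * g' * g⁻¹, hgh⟩)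
    -- hKR (G-L6t23-3) by abc-iut-w4-d099's PIN route (p-file Sec5ThetaSectionCompatOfKummerClass): «Prop 5.2 (iii) enters ONCE» —
    -- the (η₀, ν) pin above + Facts + the cyclotome dictionary m with m ∘ ν ∘ e = id + cyclotomic-character compatibility (F-1306)
    (H : (ofConnectedTemperoidData h (RD.levelStub ιX) odd_l R ιX K' constEmb constEmb_injective hinvc hinvp).Facts)
    (m : (ofConnectedTemperoidData h (RD.levelStub ιX) odd_l R ιX K' constEmb constEmb_injective hinvc hinvp).muTorsion (ofConnectedTemperoidData h (RD.levelStub ιX) odd_l R ιX K' constEmb constEmb_injective hinvc hinvp).BN (ofConnectedTemperoidData h (RD.levelStub ιX) odd_l R ιX K' constEmb constEmb_injective hinvc hinvp).N ≃* RD.mu)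
    (hme : ∀ x : RD.mu, m (ν (e x)) = x)
    (hχX : (ofConnectedTemperoidData h (RD.levelStub ιX) odd_l R ιX K' constEmb constEmb_injective hinvc hinvp).CyclotomicCharacterCompatX RD.toThetaEnvData (MulEquiv.refl _) m)
    -- hdiff reduced to Π^tp_Ÿ ⊆ H_⊙ (`hfrac`, `haut` are THEOREMS here: [FrdI] Thm 5.2 (ii) dictionary, abc-iut-L2-t9/t4)
    (hH : ∀ y : RD.PiX, y ∈ RD.PiYdd → ιX y ∈ (BiKummerSetting.mkOfConnectedTemperoid X tf hZ hP NH A₀ hA₀ hA₀').Hodot)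
    -- Thm 5.6 side: Ψ, its base shadow, Δ-transport and μ-pull data (abc-iut-L2-d4)
    (Ψ : (BiKummerSetting.mkOfConnectedTemperoid X tf hZ hP NH A₀ hA₀ hA₀').C ≌ (BiKummerSetting.mkOfConnectedTemperoid X tf hZ hP NH A₀ hA₀ hA₀').C) (Ψbs : ConnectedPart (BTemp X.Pi) ⥤ ConnectedPart (BTemp X.Pi)) [Ψbs.IsEquivalence] (eΨ : Ψ.functor ⋙ (ofConnectedTemperoidData h (RD.levelStub ιX) odd_l R ιX K' constEmb constEmb_injective hinvc hinvp).base ≅ (ofConnectedTemperoidData h (RD.levelStub ιX) odd_l R ιX K' constEmb constEmb_injective hinvc hinvp).base ⋙ Ψbs)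
    -- the [SemiAnbd] Prop 3.2 datum of `Ψ^bs` and its level-`N` descent (∃-PRODUCED: abc-iut-w5-d013 p435495 / p438441; explicit here because
    -- the conclusion names the CONSTRUCTED Δ-transport `aΨ := deltaTransport …` of abc-iut-w5-d020, p443762)
    (φ : X.Pi ≃ₜ* X.Pi) (η : Ψbs ⋙ (connectedObjects (BTemp X.Pi)).ι ≅ (connectedObjects (BTemp X.Pi)).ι ⋙ BTemp.res (φ : X.Pi →ₜ* X.Pi))
    (φQ : RD.LevelQuot ≃* RD.LevelQuot) (φΛ : RD.mu ≃* RD.mu) (hq : ∀ g : X.Pi, RD.qN ιX (φ g) = φQ (RD.qN ιX g))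
    (hι : ∀ a : RD.mu, RD.iotaN (φΛ a) = φQ (RD.iotaN a))
    (hlin : PreFrobenioidData.PreservesMor Ψ.functor (ofConnectedTemperoidData h (RD.levelStub ιX) odd_l R ιX K' constEmb constEmb_injective hinvc hinvp).IsLinear (ofConnectedTemperoidData h (RD.levelStub ιX) odd_l R ιX K' constEmb constEmb_injective hinvc hinvp).IsLinear)
    (hpull : ∀ {A A' : (BiKummerSetting.mkOfConnectedTemperoid X tf hZ hP NH A₀ hA₀ hA₀').C} (φ : A ⟶ A'), (ofConnectedTemperoidData h (RD.levelStub ιX) odd_l R ιX K' constEmb constEmb_injective hinvc hinvp).IsLinear φ → ∀ (u : (ofConnectedTemperoidData h (RD.levelStub ιX) odd_l R ιX K' constEmb constEmb_injective hinvc hinvp).muTorsion A' (ofConnectedTemperoidData h (RD.levelStub ιX) odd_l R ιX K' constEmb constEmb_injective hinvc hinvp).N)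
      (hu : Ψ.functor.mapAut A' (u : Aut A') ∈ (ofConnectedTemperoidData h (RD.levelStub ιX) odd_l R ιX K' constEmb constEmb_injective hinvc hinvp).muTorsion (Ψ.functor.obj A') (ofConnectedTemperoidData h (RD.levelStub ιX) odd_l R ιX K' constEmb constEmb_injective hinvc hinvp).N),
      Ψ.functor.mapAut A ((ofConnectedTemperoidData h (RD.levelStub ιX) odd_l R ιX K' constEmb constEmb_injective hinvc hinvp).muTorsionPull φ (ofConnectedTemperoidData h (RD.levelStub ιX) odd_l R ιX K' constEmb constEmb_injective hinvc hinvp).N u : Aut A) = ((ofConnectedTemperoidData h (RD.levelStub ιX) odd_l R ιX K' constEmb constEmb_injective hinvc hinvp).muTorsionPull (Ψ.functor.map φ) (ofConnectedTemperoidData h (RD.levelStub ιX) odd_l R ιX K' constEmb constEmb_injective hinvc hinvp).N ⟨_, hu⟩ : Aut (Ψ.functor.obj A)))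
    -- the NORMALISED Thm 5.7 transport (D_c = 1, e = 1: abc-iut-L2-d4 T1 + abc-iut-w5-d245 `capCupTransport_normalise`)
    (α : Ψ.functor.obj (ofConnectedTemperoidData h (RD.levelStub ιX) odd_l R ιX K' constEmb constEmb_injective hinvc hinvp).AN ≅ (ofConnectedTemperoidData h (RD.levelStub ιX) odd_l R ιX K' constEmb constEmb_injective hinvc hinvp).AN) (β : Ψ.functor.obj (ofConnectedTemperoidData h (RD.levelStub ιX) odd_l R ιX K' constEmb constEmb_injective hinvc hinvp).BN ≅ (ofConnectedTemperoidData h (RD.levelStub ιX) odd_l R ιX K' constEmb constEmb_injective hinvc hinvp).BN) {Dp₀ : Aut (ofConnectedTemperoidData h (RD.levelStub ιX) odd_l R ιX K' constEmb constEmb_injective hinvc hinvp).BN}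
    (hc₁ : α.inv ≫ Ψ.functor.map (ofConnectedTemperoidData h (RD.levelStub ιX) odd_l R ιX K' constEmb constEmb_injective hinvc hinvp).sCap ≫ β.hom = (ofConnectedTemperoidData h (RD.levelStub ιX) odd_l R ιX K' constEmb constEmb_injective hinvc hinvp).sCap)
    (hp₁ : α.inv ≫ Ψ.functor.map (ofConnectedTemperoidData h (RD.levelStub ιX) odd_l R ιX K' constEmb constEmb_injective hinvc hinvp).sCup ≫ β.hom = (ofConnectedTemperoidData h (RD.levelStub ιX) odd_l R ιX K' constEmb constEmb_injective hinvc hinvp).sCup ≫ Dp₀.hom) (hDp₀ : Dp₀ ∈ (ofConnectedTemperoidData h (RD.levelStub ιX) odd_l R ιX K' constEmb constEmb_injective hinvc hinvp).units (ofConnectedTemperoidData h (RD.levelStub ιX) odd_l R ιX K' constEmb constEmb_injective hinvc hinvp).BN)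
    -- [FrdI] Prop 5.6 / Thm 3.4 (iii) data at A_N (abc-iut-w5-d245's Prop 5.6 unit)
    -- the MODEL HYPOTHESES of [FrdI] Thm 3.4 (iii)/(v) at the §4 tempered Frobenioid ([EtTh] Thm 3.7 (i)(ii))
    (hD : IsOfFSMType (ConnectedPart (BTemp X.Pi))) (hslim : IsSlim (ConnectedPart (BTemp X.Pi))) (hnd : IsNonDilatingOn tf.divisorMonoid)
    (hN : ∃ A : (BiKummerSetting.mkOfConnectedTemperoid X tf hZ hP NH A₀ hA₀ hA₀').C, ¬ (PreFrobenioidData.ofModel tf.divisorMonoid tf.ratFnFunctor tf.divBNatTrans).IsGroupLikeObj A)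
    -- [EtTh] Cor 2.18 (i): the theta-related subquotients Π^tp_Ÿ, (l·Δ_Θ), … of Π^tp_X are CHARACTERISTIC (abc-iut-L2-t2's
    -- `RigidData.Cor218_i`, F-0620; discharged at the model data by abc-iut-L2-t8/L6) — supplies hP24/hγL for EVERY γ
    (h218i : RD.Cor218_i) :
    ∃ ρ : RigidityFamily (ofConnectedTemperoidData h (RD.levelStub ιX) odd_l R ιX K' constEmb constEmb_injective hinvc hinvp), IsKummerDetermined (ofConnectedTemperoidData h (RD.levelStub ιX) odd_l R ιX K' constEmb constEmb_injective hinvc hinvp) P ρ hB ∧ IsFunctorialLinear (ofConnectedTemperoidData h (RD.levelStub ιX) odd_l R ιX K' constEmb constEmb_injective hinvc hinvp) ρ ∧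
      (∀ ρ' : RigidityFamily (ofConnectedTemperoidData h (RD.levelStub ιX) odd_l R ιX K' constEmb constEmb_injective hinvc hinvp), IsKummerDetermined (ofConnectedTemperoidData h (RD.levelStub ιX) odd_l R ιX K' constEmb constEmb_injective hinvc hinvp) P ρ' hB → IsFunctorialLinear (ofConnectedTemperoidData h (RD.levelStub ιX) odd_l R ιX K' constEmb constEmb_injective hinvc hinvp) ρ' → ρ' = ρ) ∧
      CyclotomicRigidityPreserved (ofConnectedTemperoidData h (RD.levelStub ιX) odd_l R ιX K' constEmb constEmb_injective hinvc hinvp) Ψ ρ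
        (deltaTransport.{u₀, v₀, w'} ιX h odd_l R K' constEmb constEmb_injective hinvc hinvp Ψ Ψbs eΨ φ η φQ φΛ hq hι) := by
  -- every application with EXPLICIT universes (see the elaboration note of `Sec5Thm56EndKnitLevelNCarrier`)
  exact exists_rigidityFamily_unique_preserved_ofConnectedTemperoidData_levelN_carrier_roofs.{u₀, v₀, w', v₁, u₁} h odd_l R ιX K'
    constEmb constEmb_injective hinvc hinvp hB P hPpre hPproj_pin hη₀ hdies e he hPproj ν hKν hP34 hΔcnst hroof hmeet hproj H m hme hχX hH
    Ψ Ψbs eΨ (deltaTransport.{u₀, v₀, w'} ιX h odd_l R K' constEmb constEmb_injective hinvc hinvp Ψ Ψbs eΨ φ η φQ φΛ hq hι)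
    (fun A => ThetaSubquotient.psiTransport (RD.qN ιX) RD.iotaN φ φQ φΛ hq hι Ψbs η ((ofConnectedTemperoidData h (RD.levelStub ιX) odd_l R ιX K' constEmb constEmb_injective hinvc hinvp).base.obj A)
      ((ofConnectedTemperoidData h (RD.levelStub ιX) odd_l R ιX K' constEmb constEmb_injective hinvc hinvp).base.obj (Ψ.functor.obj A)) (eΨ.app A))
    (fun A y => deltaTransport_mk.{u₀, v₀, w'} ιX h odd_l R K' constEmb constEmb_injective hinvc hinvp Ψ Ψbs eΨ φ η φQ φΛ hq hι A y)
    hlin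
    (fun ψ y => ThetaSubquotient.map_psiTransport (RD.qN ιX) RD.iotaN φ φQ φΛ hq hι Ψbs η (eΨ.app _) (eΨ.app _)
      ((ofConnectedTemperoidData h (RD.levelStub ιX) odd_l R ιX K' constEmb constEmb_injective hinvc hinvp).base.map ψ) ((ofConnectedTemperoidData h (RD.levelStub ιX) odd_l R ιX K' constEmb constEmb_injective hinvc hinvp).base.map (Ψ.functor.map ψ)) (eΨ.inv.naturality ψ).symm y)
    hpull α β hc₁ hp₁ hDp₀ hD hslim hnd hN h218i
    (fun θA hθ g hg => deltaCompat_carrier_of_psiTransport.{u₀, v₀, max u₀ w'} R Ψ Ψbs ιX (strvOfBiKummerData h R)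
      (baseMap_strvOfBiKummerData h R) eΨ α β hc₁ φ η φQ φΛ hq hι θA hθ g hg)

end Connected

end ThetaFrobenioid

end Literature.AnabelianGeometry.EtaleTheta

end
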